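import Literature.Computability.AlgebraicComplexity.Bur24VNPnb0CompleteFamily
import Literature.Barriers.ValiantsHypothesis.CT23LowerBoundsFromSuccinctHittingSets
import HarnessLib

/-!
# `VNPnb⁰ ⊆ VPSPACE⁰` (Bürgisser 2024 survey, Prop. 4.12, in Poizat's form of Rem. 4.15)

P. Bürgisser, *Completeness classes in algebraic complexity theory* (arXiv:2406.06217, 2024), §4.3
(held text `paper:arxiv-2406.06217`, p0017 L105–L137, p0018 L1–L11, L34–L39):

> **Proposition 4.12.** We have `VNPnb⁰ ⊆ VPSPACE⁰`.
> **Remark 4.15.** Poizat gave an elegant characterization of `VPSPACE⁰` in terms of sequences of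
> polynomials computed by summation circuits of polynomial size. These are constant-free
> arithmetic circuits with summation gates: on input a polynomial `f` such gates carry out the
> summation `f|_{x=0} + f|_{x=1}`, where `x` is a variable occuring in `f`. Note that if allowing
> the use of such gates at the end of the computation only, the class `VNPnb⁰` is obtained.

The tree's `VPSPACE⁰` is POIZAT's class (Rem. 4.15): `IsVPSPACE0Family` of
`Literature/Barriers/ValiantsHypothesis/CT23LowerBoundsFromSuccinctHittingSets.lean` (Chatterjee–Tengse
2023, Def. 2.20 after Poizat 2008: p-bounded constant-free fan-in-two circuits with PROJECTION
gates `f ↦ f|_{x=b}` — a summation gate is two projections and a sum — over the variables of `f_n`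
and p-boundedly many bound workspace variables). The survey's Def. 4.11 (coefficient function in
`PSPACE/poly`, Koiran–Perifel) is equivalent to it by Poizat's theorem [poizat:08] / Malod 2011,
which is NOT in the tree; accordingly this file proves Prop. 4.12 and the easy half of the last
sentence of Rem. 4.15 for the tree's (Poizat-form) `VPSPACE⁰`, by the argument of Rem. 4.15: the
Boolean sum `Σ_{e ∈ {0,1}^u} g(X, e)` is `u` summation gates applied at the end to the circuit of
`g` (the tree's `ProjCircuit.boolSumCircuit`, as in its `isVPSPACE0Family_of_isVNP0Family` for the
bounded-degree class `VNP⁰`). Theorems only; 0 definitions, 0 named facts.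

* `Bur24_sec4_3_vpnb0_subset_vpspace0` — `VPnb⁰ ⊆ VPSPACE⁰` (a constant-free circuit is a
  projection circuit without projection gates);
* **`Bur24_prop_4_12`** — `VNPnb⁰ ⊆ VPSPACE⁰` (Poizat form);
* `isVPSPACE0Family_genericComputation`, `isVPSPACE0Family_malodD` — Malod's `VPnb⁰`- and
  `VNPnb⁰`-complete families `(G_n)`, `(D_n)` (`MalodGenericComputation.lean`,
  `Bur24VNPnb0CompleteFamily.lean`) lie in `VPSPACE⁰`.

Honest framing: class inclusions of a published survey, kernel-checked; nothing here bears on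
`VP ≠ VNP` or `VPnb ≠ VPSPACE`, which are NOT proved.

## References

* [Burgisser2024Completeness] P. Bürgisser, arXiv:2406.06217 (2024), §4.3, Prop. 4.12 (p0017
  L136–L137), Rem. 4.15 (p0018 L34–L39), Def. 4.11 (p0017 L123–L134).
* [ChatterjeeTengse2023] P. Chatterjee, A. Tengse, arXiv:2309.07612, Def. 2.20 (the tree's
  `IsVPSPACE0Family`); B. Poizat, *À la recherche de la définition de la complexité d'espace pour
  le calcul des polynômes à la manière de Valiant*, J. Symb. Logic 73 (2008) ([poizat:08]).
-/

noncomputable section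

open MvPolynomial

namespace Literature.Computability.AlgebraicComplexity

open Literature.Barriers.ValiantsHypothesis

universe u v

variable {σ : ℕ → Type v} [∀ N, Fintype (σ N)] [∀ N, DecidableEq (σ N)]

/-- **`VPnb⁰ ⊆ VPSPACE⁰`** (Poizat form): the p-bounded constant-free circuits of a `VPnb⁰` family,
read as projection circuits without projection gates and without workspace (`t = 0`). The degree
bound of `VP⁰` is not used (cf. the tree's `isVPSPACE0Family_of_isVP0Family`).
[cite: Burgisser2024Completeness, §4.3 Rem. 4.15 (p0018 L34–L39)] -/
theorem Bur24_sec4_3_vpnb0_subset_vpspace0 {P : ∀ N, MvPolynomial (σ N) ℤ} (h : IsVPnb0Family P) :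
    IsVPSPACE0Family P := by
  obtain ⟨hcard, C, hC, hsize⟩ := h
  refine ⟨hcard, fun _ => 0, fun N => ProjCircuit.ofArithCircuit ((C N).rename Sum.inl),
    IsPBounded.const 0, fun N => ⟨?_, ?_, ?_⟩, ?_⟩
  · exact ProjCircuit.isFanInTwo_ofArithCircuit ((hC N).1.rename _)
  · exact ProjCircuit.hasSignConstants_ofArithCircuit ((hC N).2.1.rename _)
  · simpa [ProjCircuit.Computes, ArithCircuit.Computes] using (hC N).2.2.rename Sum.inl
  · simpa [ArithCircuit.size_rename] using hsize

omit [∀ N, DecidableEq (σ N)] in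
/-- The length of the Boolean sum of a `VNPnb⁰` family is p-bounded (it is at most the number of
variables of the `VPnb⁰` witness). [cite: Burgisser2024Completeness, Def. 4.4 (p0015 L110–L111)] -/
theorem IsVNPnb0Family.exists_isPBounded {f : ∀ n, MvPolynomial (σ n) ℤ} (hf : IsVNPnb0Family f) :
    ∃ (u : ℕ → ℕ) (g : ∀ n, MvPolynomial (σ n ⊕ Fin (u n)) ℤ),
      IsPBounded u ∧ IsVPnb0Family g ∧ ∀ n, f n = boolSum (g n) := by
  obtain ⟨u, g, hg, hfg⟩ := hf
  refine ⟨u, g, hg.1.mono fun n => ?_, hg, hfg⟩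
  simp [Fintype.card_sum]

/-- **Bürgisser 2024, Prop. 4.12: `VNPnb⁰ ⊆ VPSPACE⁰`**, for the tree's (Poizat-form, Rem. 4.15)
`VPSPACE⁰` = `IsVPSPACE0Family`: the Boolean sum `f_N = Σ_{e ∈ {0,1}^{u(N)}} g_N(X, e)` of a `VPnb⁰`
family is computed by the constant-free circuit of `g_N` followed by one summation gate (two
projection gates and a sum) per bit `e_j`, the bits being the bound workspace variables — "if
allowing the use of such gates at the end of the computation only, the class `VNPnb⁰` is obtained"
(size `|C_N| + 3 u(N)`). The survey's own Def. 4.11 (coefficient function in `PSPACE/poly`) is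
equivalent to Poizat's form by [poizat:08], not formalised in the tree.
[cite: Burgisser2024Completeness, Prop. 4.12 and Rem. 4.15 (p0017 L136–L137, p0018 L34–L39)] -/
theorem Bur24_prop_4_12 {P : ∀ N, MvPolynomial (σ N) ℤ} (h : IsVNPnb0Family P) :
    IsVPSPACE0Family P := by
  obtain ⟨u, g, hu, hg, hP⟩ := h.exists_isPBounded
  obtain ⟨hcard, C, hC, hsize⟩ := hg
  refine ⟨hcard.mono fun N => by simp [Fintype.card_sum], u,
    fun N => (ProjCircuit.ofArithCircuit (C N)).boolSumCircuit (u N), hu, fun N => ⟨?_, ?_, ?_⟩, ?_⟩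
  · exact ProjCircuit.isFanInTwo_boolSumCircuit (ProjCircuit.isFanInTwo_ofArithCircuit (hC N).1) _
  · exact ProjCircuit.hasSignConstants_boolSumCircuit
      (ProjCircuit.hasSignConstants_ofArithCircuit (hC N).2.1) _
  · rw [ProjCircuit.Computes, ProjCircuit.eval_boolSumCircuit _ le_rfl, ProjCircuit.eval_ofArithCircuit,
      partialBoolSum_eq_rename_boolSum, show (C N).eval = g N from (hC N).2.2, ← hP N]
  · refine (IsPBounded.add_holds hsize (IsPBounded.mul_holds (IsPBounded.const 3) hu)).mono fun N => ?_
    rw [ProjCircuit.size_boolSumCircuit _ le_rfl, ProjCircuit.size_ofArithCircuit]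

/-- **Malod's `VPnb⁰`-complete family `(G_n)` lies in `VPSPACE⁰`.**
[cite: Burgisser2024Completeness, §4.2 (4.3) and §4.3 (p0016 L52–L54, p0018 L1–L11)] -/
theorem isVPSPACE0Family_genericComputation :
    IsVPSPACE0Family (σ := MalodGeneric.Var) fun n => MalodGeneric.genericComputation ℤ n :=
  Bur24_sec4_3_vpnb0_subset_vpspace0 isVPnb0Family_genericComputation

/-- **Malod's `VNPnb⁰`-complete family `(D_n)` lies in `VPSPACE⁰`** ("It suffices to show that the
coefficient function of the `VNPnb⁰`-complete sequence `(D_n)` … is in `PSPACE/poly`" — here in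
Poizat's form, from Prop. 4.12). [cite: Burgisser2024Completeness, Prop. 4.12 proof outline (p0018 L1–L11)] -/
theorem isVPSPACE0Family_malodD :
    IsVPSPACE0Family (σ := MalodGeneric.DVar) fun n => MalodGeneric.malodD ℤ n :=
  Bur24_prop_4_12 MalodGeneric.isVNPnb0Family_malodD

/-! ## Constants of a field for free: `VPnb^F ⊆ VPSPACE^F`

"The question of whether `VPnb^𝔽 = VPSPACE^𝔽` holds over a field `𝔽`" (p0018 L13) presupposes the
inclusion `VPnb^𝔽 ⊆ VPSPACE^𝔽`; for the tree's classes — `IsVPnbFamily`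
(`Bur24UnboundedDegreeClassesField.lean`: "circuits using constants in `𝔽` for free") and
`IsVPSPACEFamily F` (CT23 Def. 2.22: an integer `VPSPACE⁰` family with some variables set to
constants of `F`) — it follows from the universality of Malod's generic computation
(`Bur24_sec4_2_isVPnbFamily_iff_specialisation`: `f_n = G_{t(n)}(φ_n)`, `φ_n` variables/constants):
`f_n` is the integer polynomial `G_{t(n)}` with its variable slots renamed into `σ_n` and its
constant slots into workspace variables, the latter then set to the constants. -/

namespace MalodGeneric

/-- The generic computation is defined over `ℤ`: a ring map `k → k'` sends `G_n` over `k` to `G_n`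
over `k'` (value by value). [cite: Burgisser2024Completeness, §4.2 (4.3) (p0016 L42–L50)] -/
theorem map_value {k : Type*} {k' : Type*} [CommRing k] [CommRing k'] (f : k →+* k') (n : ℕ) :
    ∀ q, MvPolynomial.map f (value k n q) = value k' n q := by
  intro q
  induction q using Nat.strong_induction_on with
  | _ q ih =>
    by_cases hq : q ≤ n
    · rw [value_input k n hq, value_input k' n hq, input, input]
      split_ifs <;> simp
    · have hnq : n < q := not_le.1 hq
      rw [value_level k n hnq, value_level k' n hnq, map_mul]
      have key : ∀ s : Bool, MvPolynomial.map f
          (((List.range q).map fun q' => coef k n (q - n) q' s * value k n q').sum) =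
          ((List.range q).map fun q' => coef k' n (q - n) q' s * value k' n q').sum := by
        intro s
        rw [map_list_sum, List.map_map]
        refine congrArg List.sum (List.map_congr_left fun q' hq' => ?_)
        rw [Function.comp_apply, map_mul, ih q' (List.mem_range.1 hq'), coef, coef, map_X]
      rw [key, key]

/-- `map f (G_n) = G_n`. [cite: Burgisser2024Completeness, §4.2 (4.3) (p0016 L42–L54)] -/
theorem map_genericComputation {k : Type*} {k' : Type*} [CommRing k] [CommRing k']
    (f : k →+* k') (n : ℕ) :
    MvPolynomial.map f (genericComputation k n) = genericComputation k' n :=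
  map_value f n _

end MalodGeneric

/-- `(G_{t(n)})_n ∈ VPnb⁰` for every p-bounded reindexing `t` (the circuit of `G_{t(n)}` has size
`t(n)(8 t(n) + 1)`). [cite: Burgisser2024Completeness, §4.2 (p0016 L52–L54)] -/
theorem isVPnb0Family_genericComputation_comp {t : ℕ → ℕ} (ht : IsPBounded t) :
    IsVPnb0Family (σ := fun n => MalodGeneric.Var (t n))
      fun n => MalodGeneric.genericComputation ℤ (t n) := by
  have hsq : IsPBounded fun n => (t n + 1) ^ 2 :=
    IsPBounded.pow_holds (IsPBounded.add_holds ht (IsPBounded.const 1)) 2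
  refine ⟨(IsPBounded.mul_holds (IsPBounded.const 15) hsq).mono fun n => ?_,
    fun n => MalodGeneric.circuit ℤ (t n), fun n =>
      ⟨MalodGeneric.circuit_isFanInTwo ℤ (t n), MalodGeneric.circuit_hasSignConstants ℤ (t n),
        MalodGeneric.circuit_computes ℤ (t n)⟩,
    (IsPBounded.mul_holds (IsPBounded.const 9) hsq).mono fun n => ?_⟩
  · simp only [MalodGeneric.Var, Fintype.card_sum, Fintype.card_prod, Fintype.card_fin,
      Fintype.card_bool]
    nlinarith
  · show (MalodGeneric.circuit ℤ (t n)).size ≤ 9 * (t n + 1) ^ 2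
    rw [MalodGeneric.circuit_size]
    nlinarith

/-- **`VPnb^F ⊆ VPSPACE^F`** (the inclusion presupposed by "the question of whether
`VPnb^𝔽 = VPSPACE^𝔽` holds", p0018 L13), for the tree's `IsVPnbFamily` and Poizat-form
`IsVPSPACEFamily F`: write `f_n = G_{t(n)}(φ_n)` (`Bur24_sec4_2_isVPnbFamily_iff_specialisation`),
rename the variable slots of the INTEGER polynomial `G_{t(n)}` into `σ_n` and all slots into
workspace variables carrying the constants of `φ_n`.
[cite: Burgisser2024Completeness, §4.3 (p0017 L133–L134, p0018 L13–L17)] -/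
theorem IsVPnbFamily.isVPSPACEFamily (F : Type u) [Field F] {f : ∀ n, MvPolynomial (σ n) F}
    (hf : IsVPnbFamily f) : IsVPSPACEFamily F f := by
  classical
  obtain ⟨hcard, t, ht, hφ⟩ := (Bur24_sec4_2_isVPnbFamily_iff_specialisation f).1 hf
  choose φ hφv hfφ using hφ
  -- workspace: one variable per slot of `G_{t n}`
  let u : ℕ → ℕ := fun n => Fintype.card (MalodGeneric.Var (t n))
  let e : ∀ n, MalodGeneric.Var (t n) ≃ Fin (u n) := fun n => Fintype.equivFin _
  obtain ⟨ρ, hρ⟩ : ∃ ρ : ∀ n, MalodGeneric.Var (t n) → σ n ⊕ Fin (u n), ∀ n i,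
      ρ n i = if h : ∃ x, φ n i = X x then Sum.inl h.choose else Sum.inr (e n i) :=
    ⟨_, fun _ _ => rfl⟩
  obtain ⟨κ, hκ⟩ : ∃ κ : ∀ n, Fin (u n) → F, ∀ n j,
      κ n j = if h : ∃ c, φ n ((e n).symm j) = C c then h.choose else 0 :=
    ⟨_, fun _ _ => rfl⟩
  have hcomp : ∀ n i, (Sum.elim X fun j => C (κ n j) : σ n ⊕ Fin (u n) → MvPolynomial (σ n) F)
      (ρ n i) = φ n i := by
    intro n i
    rw [hρ]
    split_ifs with h
    · rw [Sum.elim_inl, ← h.choose_spec]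
    · rcases hφv n i with hx | ⟨c, hc⟩
      · exact absurd hx h
      · have h' : ∃ c', φ n ((e n).symm (e n i)) = C c' :=
          ⟨c, by rw [Equiv.symm_apply_apply, hc]⟩
        rw [Sum.elim_inr, hκ, dif_pos h']
        calc C h'.choose = φ n ((e n).symm (e n i)) := h'.choose_spec.symm
          _ = φ n i := congrArg (φ n) (Equiv.symm_apply_apply _ _)
  have hG := isVPnb0Family_genericComputation_comp ht
  refine ⟨u, fun n => MvPolynomial.rename (ρ n) (MalodGeneric.genericComputation ℤ (t n)), κ,
    Bur24_sec4_3_vpnb0_subset_vpspace0 (hG.rename ρ ?_), fun n => ?_⟩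
  · exact (IsPBounded.add_holds hcard hG.1).mono fun n => by simp [u, Fintype.card_sum]
  · have hfun : ((Sum.elim X fun j => C (κ n j)) ∘ ρ n) = φ n := funext fun i => hcomp n i
    rw [MvPolynomial.map_rename, MalodGeneric.map_genericComputation, MvPolynomial.aeval_rename,
      hfun]
    exact hfφ n

/-- Hence `(G_n)` over a field lies in `VPSPACE^F`. [cite: Burgisser2024Completeness, §4.3 (p0017 L133–L134)] -/
theorem isVPSPACEFamily_genericComputation (F : Type u) [Field F] :
    IsVPSPACEFamily F (σ := MalodGeneric.Var) fun n => MalodGeneric.genericComputation F n :=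
  (isVPnbFamily_genericComputation F).isVPSPACEFamily F

/-! ## Rem. 4.15: summation gates at the end of the computation only give exactly `VNPnb⁰` -/

/-- **Bürgisser 2024, Rem. 4.15: "Poizat gave an elegant characterization of `VPSPACE⁰` in terms
of sequences of polynomials computed by summation circuits of polynomial size. … Note that if
allowing the use of such gates at the end of the computation only, the class `VNPnb⁰` is
obtained."**  In the tree's Poizat-model vocabulary (`ProjCircuit`, `CT23LowerBoundsFromSuccinctHittingSets.lean`):
a family `(f_n)` is in `VNPnb⁰` (Def. 4.4, `IsVNPnb0Family`) iff `#σ_n` is `p`-bounded and `f_n`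
(read in the ring with `u(n)` `p`-boundedly many bound workspace variables) is computed by a
`p`-size constant-free fan-in-two circuit WITHOUT projection gates followed by the block of `u(n)`
summation gates over the workspace variables (`ProjCircuit.boolSumCircuit`, one summation gate —
two projections and a sum — per bound variable). [cite: Burgisser2024Completeness, Rem. 4.15 (p0018 L34–L39)] -/
theorem Bur24_rem_4_15_iff (f : ∀ N, MvPolynomial (σ N) ℤ) :
    IsVNPnb0Family f ↔
      IsPBounded (fun N => Fintype.card (σ N)) ∧
        ∃ (u : ℕ → ℕ) (C : ∀ N, ArithCircuit ℤ (σ N ⊕ Fin (u N))),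
          IsPBounded u ∧ (∀ N, (C N).IsFanInTwo ∧ (C N).HasSignConstants) ∧
            (IsPBounded fun N => (C N).size) ∧
              ∀ N, ((ProjCircuit.ofArithCircuit (C N)).boolSumCircuit (u N)).Computes
                (rename Sum.inl (f N)) := by
  constructor
  · intro h
    obtain ⟨u, g, hu, hg, hP⟩ := h.exists_isPBounded
    obtain ⟨hcard, C, hC, hsize⟩ := hg
    refine ⟨hcard.mono fun N => by simp [Fintype.card_sum], u, C, hu,
      fun N => ⟨(hC N).1, (hC N).2.1⟩, hsize, fun N => ?_⟩
    rw [ProjCircuit.Computes, ProjCircuit.eval_boolSumCircuit _ le_rfl, ProjCircuit.eval_ofArithCircuit,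
      partialBoolSum_eq_rename_boolSum, show (C N).eval = g N from (hC N).2.2, ← hP N]
  · rintro ⟨hcard, u, C, hu, hC, hsize, hf⟩
    refine ⟨u, fun N => (C N).eval, ⟨(IsPBounded.add_holds hcard hu).mono fun N => by
      simp [Fintype.card_sum], C, fun N => ⟨(hC N).1, (hC N).2, rfl⟩, hsize⟩, fun N => ?_⟩
    have h := hf N
    rw [ProjCircuit.Computes, ProjCircuit.eval_boolSumCircuit _ le_rfl, ProjCircuit.eval_ofArithCircuit,
      partialBoolSum_eq_rename_boolSum] at h
    exact (rename_injective _ Sum.inl_injective h).symm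

/-! ## §4.3: `VP ⊆ VPSPACE_b`, and the transfer «`VPnb = VPSPACE` ⟹ `VP = VPSPACE_b`» -/

/-- **`VP^F ⊆ VPSPACE^F_b`** (the bounded-degree part of `VPSPACE^F`, CT23's `IsVPSPACEbFamily`):
`VP ⊆ VPnb ⊆ VPSPACE` (`IsVPnbFamily.isVPSPACEFamily`) and `VP` families have `p`-bounded degree.
[cite: Burgisser2024Completeness, §4.3 (p0018 L13–L17)] -/
theorem IsVPFamily.isVPSPACEbFamily (F : Type u) [Field F] {f : ∀ n, MvPolynomial (σ n) F}
    (hf : IsVPFamily f) : IsVPSPACEbFamily F f :=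
  ⟨hf.isVPnbFamily.isVPSPACEFamily F, hf.1.2⟩

/-- **Bürgisser 2024, §4.3 (p0018 L13–L17): "If we denote by `VPSPACE^F_b` the subclass of
`VPSPACE^F` obtained by requiring `deg f_n` to be polynomially bounded in `n`, then it is shown in
[koir-perifel-R] that `VPnb^F = VPSPACE^F` if and only if `VP^F = VPSPACE^F_b`"** — the EASY
implication "⟹" (degree truncation is free in the tree's `IsVPnbFamily`/`IsVPFamily`: a `VPnb`
family of `p`-bounded degree is a `VP` family), with the class equalities rendered by their
non-trivial inclusions (`VPnb ⊆ VPSPACE`, `VP ⊆ VPSPACE_b` hold unconditionally: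
`IsVPnbFamily.isVPSPACEFamily`, `IsVPFamily.isVPSPACEbFamily`), for families over a fixed
variable-type sequence `σ`.  The converse implication of Koiran–Perifel (a `VPSPACE` family is a
power substitution of its `p`-bounded-degree binary splitting, which needs coefficient extraction
inside Poizat's summation-circuit model) is NOT proved here.
[cite: Burgisser2024Completeness, §4.3 (p0018 L13–L17)] -/
theorem Bur24_sec4_3_vp_eq_vpspaceb_of_vpnb_eq_vpspace (F : Type u) [Field F]
    (h : ∀ f : ∀ n, MvPolynomial (σ n) F, IsVPSPACEFamily F f → IsVPnbFamily f)
    (f : ∀ n, MvPolynomial (σ n) F) (hf : IsVPSPACEbFamily F f) : IsVPFamily f := by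
  have hnb := (isVPnbFamily_iff_isPComputable f).1 (h f hf.1)
  exact ⟨⟨hnb.1, hf.2⟩, hnb.2⟩

end Literature.Computability.AlgebraicComplexity

end
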